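import Literature.Probability.Percolation.Z2LatticePivotalOpenClause
import Literature.Probability.Percolation.QuadSubquadThickening
import Literature.Probability.Percolation.Z2DrawnArcs
import HarnessLib

/-!
# Lattice pivotality of an edge of `δℤ²` versus `QuadConfig.IsPivotalAt`: the converse half

Topic `Literature/Probability/Percolation`; sequel to `Z2LatticePivotalOpenClause.lean`, which
proves that a lattice-pivotal non-straddling edge `e = s(x, x + eᵢ)` of `δℤ²` (`Q ∈ ω_δ` but
`Q ∉ (ω ∖ {e})_δ`) is open-pivotal at its midpoint for the configuration `ω_δ = z2QuadConfig D δ ω`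
in Schramm–Smirnov's space `ℋ_D` — the open clause of `QuadConfig.IsPivotalAt`
(`FlipFairKernel.lean`; Garban–Pete–Schramm, *Pivotal, cluster and interface measures for
critical planar percolation*, JAMS 26 (2013), §1.1: a point is "pivotal for a quad if changing its
state changes the crossing event").  Here the converse:

* `not_mem_z2QuadConfig_sdiff_of_isPivotalAt` — **if `Q ∈ ω_δ` and the midpoint of `e` is pivotal
  for `Q` in `ω_δ`, then `Q ∉ (ω ∖ {e})_δ`** (`δ > 0`, any quad, any edge).  Proof: a crossing of
  `Q` drawn on the open edges of `ω ∖ {e}` contains a crossing ARC (`Z2DrawnArcs.lean`); the drawn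
  edges of `ω ∖ {e}` form a closed set missing the midpoint of `e`, hence a ball `B(mid e, r)`; the
  sub-quad thickening lemma (`Quad.exists_subquad_isCrossing_subset`, `QuadSubquadThickening.lean`)
  turns the arc into a crossed sub-quad of `Q` with landing sides inside those of `Q` and carrier
  off `B̄(mid e, r/2)`, still crossed inside the open edges of `ω` — contradicting the open clause
  at radius `r/2`;
* `isPivotalAt_z2QuadConfig_iff_not_mem_sdiff` — with the first half: **for a crossed quad and a
  non-straddling edge, open-pivotality at the midpoint of `e` is equivalent to lattice pivotality
  of `e`**.

Everything is proved; no named fact is introduced.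

## References

* C. Garban, G. Pete, O. Schramm, *Pivotal, cluster and interface measures for critical planar
  percolation*, JAMS 26 (2013), arXiv:1008.1378, §1.1. [GarbanPeteSchramm2013Pivotal]
* O. Schramm, S. Smirnov, Ann. Probab. 39 (2011), arXiv:1101.5820, §1.3. [SchrammSmirnov2011]
-/

noncomputable section

open Set Metric
open Literature.Topology.PlaneTopology
open Literature.Probability.LatticeModels

namespace Literature.Probability.Percolation

open QuadCrossing

variable {D : Set ℂ} {δ : ℝ} {ω : BondConfig (Site 2)} {x : Site 2} {i : Fin 2}

/-- **Crossings drawn on the open edges contain crossing arcs.**  A crossing `K` of a quad `Q`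
inside `openEdgeUnion δ ω` (`δ > 0`) contains a simple arc from a point of `∂₀Q` to a point of
`∂₂Q` (opposite sides are disjoint, and `K` is arc-connected, `exists_isSimpleArc_of_subset_openEdgeUnion`).
[cite: SchrammSmirnov2011, §1.3 (connected = path-connected crossings in the discrete setting)] -/
theorem QuadCrossing.Quad.IsCrossing.exists_isSimpleArc (hδ : 0 < δ) {Q : Quad D} {K : Set ℂ}
    (hK : Q.IsCrossing K) (hKO : K ⊆ openEdgeUnion δ ω) :
    ∃ L p q, L ⊆ K ∧ IsSimpleArc L p q ∧ p ∈ Q.side 0 ∧ q ∈ Q.side 2 := by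
  obtain ⟨hKc, hKconn, -, ⟨p, hpK, hp⟩, ⟨q, hqK, hq⟩⟩ := hK
  have hpq : p ≠ q := fun h =>
    Set.disjoint_left.1 (Q.disjoint_side_side_add_two 0) hp (by rw [h]; exact hq)
  obtain ⟨L, hLK, hL⟩ := exists_isSimpleArc_of_subset_openEdgeUnion hδ hKc hKconn hKO hpK hqK hpq
  exact ⟨L, p, q, hLK, hL, hp, hq⟩

/-- The midpoint of `e = s(x, x + eᵢ)` is off the drawn edges of `ω ∖ {e}` (`δ > 0`): a point of the
segment of `e` on another drawn edge is an end of `e`, at distance `δ/2` from the midpoint.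
[folklore] -/
theorem edgeMidpoint_not_mem_openEdgeUnion_sdiff (hδ : 0 < δ) :
    edgeMidpoint δ x i ∉ openEdgeUnion δ (ω \ {edgeFrom x i}) := by
  intro h
  have hd1 := dist_meshPoint_edgeMidpoint_eq hδ.le x i
  have hd2 := dist_meshPoint_add_single_edgeMidpoint_eq hδ.le x i
  rcases eq_ends_of_mem_segment_of_mem_openEdgeUnion_sdiff hδ.ne' (edgeMidpoint_mem_segment δ x i)
    h with h1 | h1
  · rw [← h1, dist_self] at hd1; linarith
  · rw [← h1, dist_self] at hd2; linarith

/-- **Open-pivotal at the midpoint ⟹ lattice-pivotal.**  Let `δ > 0`, `e = s(x, x + eᵢ)`, `Q` a quad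
crossed in `ω` (`Q ∈ ω_δ`) such that the midpoint of `e` is pivotal for `Q` in the configuration
`ω_δ` (`QuadConfig.IsPivotalAt`; the closed clause is excluded by `Q ∈ ω_δ`).  Then `Q` is not
crossed in `ω ∖ {e}`.  See the module docstring for the proof (crossing arc, a ball around the
midpoint off the drawn edges of `ω ∖ {e}`, sub-quad thickening).
[cite: GarbanPeteSchramm2013Pivotal, §1.1 (pivotal points for a quad)] -/
theorem not_mem_z2QuadConfig_sdiff_of_isPivotalAt (hδ : 0 < δ) {Q : Quad D}
    (hQ : Q ∈ z2QuadConfig D δ ω)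
    (hpiv : QuadConfig.IsPivotalAt (z2QuadConfig D δ ω) (edgeMidpoint δ x i) Q) :
    Q ∉ z2QuadConfig D δ (ω \ {edgeFrom x i}) := by
  intro hQe
  rcases hpiv with ⟨-, hopen⟩ | ⟨hQ', -⟩
  swap
  · exact hQ' hQ
  obtain ⟨K, hK, hKO⟩ := (mem_z2QuadConfig_iff_exists_isCrossing hδ).1 hQe
  -- a ball around the midpoint off the closed set of drawn edges of `ω ∖ {e}`
  obtain ⟨r, hr, hball⟩ : ∃ r > 0,
      ball (edgeMidpoint δ x i) r ⊆ (openEdgeUnion δ (ω \ {edgeFrom x i}))ᶜ :=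
    Metric.isOpen_iff.1 (isClosed_openEdgeUnion hδ _).isOpen_compl _
      (edgeMidpoint_not_mem_openEdgeUnion_sdiff hδ)
  -- a crossing arc inside `K`, thickened off the closed ball of radius `r/2`
  obtain ⟨L, p, q, hLK, hL, hp, hq⟩ := hK.exists_isSimpleArc hδ hKO
  have hLC : Disjoint L (closedBall (edgeMidpoint δ x i) (r / 2)) :=
    Set.disjoint_left.2 fun z hz hzb =>
      hball (closedBall_subset_ball (by linarith) hzb) (hKO (hLK hz))
  obtain ⟨Q', hcar, h0, h2, K', hK'L, hK'⟩ := Q.exists_subquad_isCrossing_subset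
    isClosed_closedBall hL (hLK.trans hK.2.2.1) hp hq hLC
  refine hopen (r / 2) (by positivity) Q'
    (fun z hz => ⟨(hcar hz).1, fun hzb => (hcar hz).2 (ball_subset_closedBall hzb)⟩) h0 h2 ?_
  exact (mem_z2QuadConfig_iff_exists_isCrossing hδ).2 ⟨K', hK',
    (hK'L.trans hLK).trans (hKO.trans (openEdgeUnion_mono δ Set.sdiff_subset))⟩

/-- **Lattice pivotality = open-pivotality at the midpoint, for crossed quads and non-straddling
edges.**  Let `δ > 0`, `e = s(x, x + eᵢ)`, `Q ∈ ω_δ` a quad whose landing sides `∂₀Q`, `∂₂Q` miss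
the drawn segment of `e`.  Then the midpoint of `e` is pivotal for `Q` in `ω_δ` iff
`Q ∉ (ω ∖ {e})_δ` (`isPivotalAt_z2QuadConfig_of_not_mem_sdiff` and
`not_mem_z2QuadConfig_sdiff_of_isPivotalAt`).
[cite: GarbanPeteSchramm2013Pivotal, §1.1 (pivotal points for a quad)] -/
theorem isPivotalAt_z2QuadConfig_iff_not_mem_sdiff (hδ : 0 < δ) {Q : Quad D}
    (hQ : Q ∈ z2QuadConfig D δ ω)
    (hns : segment ℝ (meshPoint δ x) (meshPoint δ (x + Pi.single i 1)) ∩ (Q.side 0 ∪ Q.side 2) = ∅) :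
    QuadConfig.IsPivotalAt (z2QuadConfig D δ ω) (edgeMidpoint δ x i) Q ↔
      Q ∉ z2QuadConfig D δ (ω \ {edgeFrom x i}) :=
  ⟨not_mem_z2QuadConfig_sdiff_of_isPivotalAt hδ hQ,
    fun h => isPivotalAt_z2QuadConfig_of_not_mem_sdiff hδ hQ h hns⟩

end Literature.Probability.Percolation
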